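import Summits.QuantumFields.YangMills.Theorems.CurvatureBoostCovariance.Negative.Unbundled
import Summits.QuantumFields.YangMills.Theorems.NPointIsotropy.Negative.NPointRegularJunk
import Summits.QuantumFields.YangMills.Theorems.MirrorModularBoostsCurvatureBoostCovarianceRayPositivityCore
import Summits.QuantumFields.YangMills.Theorems.MirrorModularBoostsPlanarSpectralConeDensityHelpers
import Literature.MathematicalPhysics.QuantumFieldTheory.OSReconstructionNoE1
import Summits.QuantumFields.YangMills.Theorems.MirrorModularBoostsSoftKernelBoostCovarianceInsertionOps
import Summits.QuantumFields.YangMills.Theorems.MirrorModularBoostsSoftKernelBoostCovarianceBumpChainLink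

/-!
# Assembly piece S1 — sums of field vectors, the identity theorem on a rectangle, Schwartz limits from seminorm control

Line `Sketch` of crux `MirrorModularBoosts.SoftKernelBoostCovariance` (stmt-QuantumFields-14999): a piece of the LEAD'S ASSEMBLY
(T7, `stub_chainAssembly` of the registered skeleton `Cruxes/SoftKernelBoostCovariance/Lines/Sketch.lean` + `Lines/SketchAsm.lean`),
(v2: reuses the landed `isTimeOrdered_zero'` of …InsertionOps and `isOpen_rect'` of …BumpChainLink) landed under the registered conjunction `stub_asmSuperpositionTools` (helper package; the assembly's later pieces import this module).

Exported: `isTimeOrdered_finset_sum`, `fieldVec_finset_sum`, `eqOn_rect_of_eq_real`, `tendsto_schwartz_of_seminorm`.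
-/

noncomputable section

namespace Summit.QuantumFields.YangMills.Theorems.SoftKernelBoostCovariance.Sketch

open scoped BigOperators SchwartzMap InnerProductSpace
open MeasureTheory Filter Topology
open Literature.MathematicalPhysics.QuantumLattice Literature.MathematicalPhysics.AQFT
  Literature.MathematicalPhysics.QuantumFieldTheory
open Summit.QuantumFields.YangMills.Theorems.NPointIsotropy.Negative (E4)
open Summit.QuantumFields.YangMills.Theorems.CurvatureBoostCovariance.Negative
  (OSPackage Translations Hypercubic EightFrameRP PlanarCone PlanarInvariant)
open Summit.QuantumFields.YangMills.Cruxes.PlanarSpectralCone.PositivityDiscToOperatorCone.Density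
  (isTimeOrdered_add fieldVec_add fieldVec_smul fieldVec_congr fieldVec_zero tendsto_fieldVec)

/-- Finite linear combinations of time-ordered test functions are time-ordered. -/
theorem isTimeOrdered_finset_sum {n : ℕ} {ι : Type*} (s : Finset ι) (lam : ι → ℂ) (T : ι → 𝓢((Fin n → E4), ℂ))
    (hT : ∀ i, IsTimeOrdered (T i)) : IsTimeOrdered (∑ i ∈ s, lam i • T i) := by
  classical
  induction s using Finset.induction_on with
  | empty => simpa using isTimeOrdered_zero'
  | insert a s ha ih =>
    rw [Finset.sum_insert ha]
    exact isTimeOrdered_add (OSReconstructionNoE1.isTimeOrdered_smul _ (hT a)) ih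

/-- **Field vectors of finite linear combinations**: `Ψ_{Σ λᵢ Tᵢ} = Σ λᵢ Ψ_{Tᵢ}`. -/
theorem fieldVec_finset_sum {S₁ : SchwingerFamily E4} (h : OSReconstructionNoE1 S₁.toLabelled) {n : ℕ} {ι : Type*}
    (s : Finset ι) (lam : ι → ℂ) (T : ι → 𝓢((Fin n → E4), ℂ)) (hT : ∀ i, IsTimeOrdered (T i))
    (hs : IsTimeOrdered (∑ i ∈ s, lam i • T i)) :
    h.fieldVec n (fun _ => ()) (∑ i ∈ s, lam i • T i) hs = ∑ i ∈ s, lam i • h.fieldVec n (fun _ => ()) (T i) (hT i) := by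
  classical
  induction s using Finset.induction_on with
  | empty =>
    rw [fieldVec_congr h (Finset.sum_empty (f := fun i => lam i • T i)) hs isTimeOrdered_zero',
      fieldVec_zero h, Finset.sum_empty]
  | insert a s ha ih =>
    have hs' : IsTimeOrdered (∑ i ∈ s, lam i • T i) := isTimeOrdered_finset_sum s lam T hT
    have ha' : IsTimeOrdered (lam a • T a) := OSReconstructionNoE1.isTimeOrdered_smul _ (hT a)
    rw [fieldVec_congr h (Finset.sum_insert ha (f := fun i => lam i • T i)) hs (isTimeOrdered_add ha' hs'),
      fieldVec_add h ha' hs', fieldVec_smul h (lam a) (hT a), ih hs', Finset.sum_insert ha]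

/-- The rectangle is convex. -/
theorem convex_rect_asm (ε R : ℝ) : Convex ℝ {ζ : ℂ | |ζ.re| < ε ∧ |ζ.im| < R} := by
  have hre : IsLinearMap ℝ fun w : ℂ => w.re := ⟨fun u v => Complex.add_re u v, fun c u => Complex.smul_re c u⟩
  have him : IsLinearMap ℝ fun w : ℂ => w.im := ⟨fun u v => Complex.add_im u v, fun c u => Complex.smul_im c u⟩
  have e : {ζ : ℂ | |ζ.re| < ε ∧ |ζ.im| < R} =
      ({ζ : ℂ | -ε < ζ.re} ∩ {ζ : ℂ | ζ.re < ε}) ∩ ({ζ : ℂ | -R < ζ.im} ∩ {ζ : ℂ | ζ.im < R}) := by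
    ext ζ; simp only [Set.mem_setOf_eq, Set.mem_inter_iff, abs_lt]
  rw [e]
  exact ((convex_halfSpace_gt hre _).inter (convex_halfSpace_lt hre _)).inter
    ((convex_halfSpace_gt him _).inter (convex_halfSpace_lt him _))

/-- **Identity theorem on a rectangle for vector-valued holomorphic functions agreeing on the real segment.** -/
theorem eqOn_rect_of_eq_real {H : Type*} [NormedAddCommGroup H] [NormedSpace ℂ H] [CompleteSpace H] {ε R : ℝ}
    (hε : 0 < ε) (hR : 0 < R) {f g : ℂ → H}
    (hf : DifferentiableOn ℂ f {ζ : ℂ | |ζ.re| < ε ∧ |ζ.im| < R})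
    (hg : DifferentiableOn ℂ g {ζ : ℂ | |ζ.re| < ε ∧ |ζ.im| < R})
    (hfg : ∀ θ : ℝ, |θ| < ε → f θ = g θ) :
    Set.EqOn f g {ζ : ℂ | |ζ.re| < ε ∧ |ζ.im| < R} := by
  set D : Set ℂ := {ζ : ℂ | |ζ.re| < ε ∧ |ζ.im| < R} with hD
  have hDo : IsOpen D := isOpen_rect' ε R
  have hfa : AnalyticOnNhd ℂ f D := hf.analyticOnNhd hDo
  have hga : AnalyticOnNhd ℂ g D := hg.analyticOnNhd hDo
  have h0D : (0 : ℂ) ∈ D := by simp [hD, hε, hR]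
  have hfreq : ∃ᶠ z in 𝓝[≠] (0 : ℂ), f z = g z := by
    have htend : Tendsto (fun s : ℝ => (s : ℂ)) (𝓝[>] 0) (𝓝[≠] 0) := by
      have h1 : Tendsto (fun s : ℝ => (s : ℂ)) (𝓝[>] 0) (𝓝[{0}ᶜ] ((0 : ℝ) : ℂ)) :=
        Complex.continuous_ofReal.continuousWithinAt.tendsto_nhdsWithin fun s hs =>
          Complex.ofReal_ne_zero.2 (ne_of_gt hs)
      simpa using h1
    have hev : ∀ᶠ s : ℝ in 𝓝[>] 0, f (s : ℂ) = g (s : ℂ) := by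
      have : ∀ᶠ s : ℝ in 𝓝[>] (0 : ℝ), s < ε := (eventually_lt_nhds hε).filter_mono nhdsWithin_le_nhds
      filter_upwards [this, self_mem_nhdsWithin] with s hs hs0
      exact hfg s (abs_lt.2 ⟨by linarith [Set.mem_Ioi.1 hs0], hs⟩)
    exact htend.frequently hev.frequently
  exact hfa.eqOn_of_preconnected_of_frequently_eq hga (convex_rect_asm ε R).isPreconnected h0D hfreq

/-- **Schwartz convergence from seminorm control**: if every seminorm `(p, q)` of `F - F_k` is `< 1/(k+1)` as soon as
`p, q ≤ k`, then `F_k → F` in `𝓢`. -/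
theorem tendsto_schwartz_of_seminorm {D : Type*} [NormedAddCommGroup D] [NormedSpace ℝ D]
    (F : 𝓢(D, ℂ)) (Fk : ℕ → 𝓢(D, ℂ))
    (hFk : ∀ (k p q : ℕ), p ≤ k → q ≤ k → SchwartzMap.seminorm ℝ p q (F - Fk k) < 1 / ((k : ℝ) + 1)) :
    Tendsto Fk atTop (𝓝 F) := by
  rw [(schwartz_withSeminorms ℝ D ℂ).tendsto_nhds_atTop]
  rintro ⟨p, q⟩ η hη
  obtain ⟨k₀, hk₀⟩ := exists_nat_gt (1 / η)
  refine ⟨max (max p q) k₀, fun k hk => ?_⟩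
  have hpk : p ≤ k := (le_max_left p q).trans ((le_max_left _ _).trans hk)
  have hqk : q ≤ k := (le_max_right p q).trans ((le_max_left _ _).trans hk)
  have hk₀k : (k₀ : ℝ) ≤ k := by exact_mod_cast (le_max_right _ _).trans hk
  have h1 := hFk k p q hpk hqk
  rw [SchwartzMap.schwartzSeminormFamily_apply]
  have hsymm : SchwartzMap.seminorm ℝ p q (Fk k - F) = SchwartzMap.seminorm ℝ p q (F - Fk k) := by
    rw [← neg_sub, map_neg_eq_map]
  rw [hsymm]
  refine h1.trans_le ?_
  rw [div_le_iff₀ (by positivity)]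
  have : 1 / η < (k : ℝ) + 1 := hk₀.trans_le (by linarith)
  rw [div_lt_iff₀ hη] at this
  linarith

/-- **Registered helper package `stub_asmSuperpositionTools` of the lead's assembly (line `Sketch`)**: the conjunction of
`isTimeOrdered_finset_sum`, `fieldVec_finset_sum`, `eqOn_rect_of_eq_real`, `tendsto_schwartz_of_seminorm`. -/
theorem stub_asmSuperpositionTools :
    open Literature.MathematicalPhysics.QuantumLattice Literature.MathematicalPhysics.AQFT
      Literature.MathematicalPhysics.QuantumFieldTheory
      Summit.QuantumFields.YangMills.Theorems.CurvatureBoostCovariance.Negative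
      Summit.QuantumFields.YangMills.Theorems.NPointIsotropy.Negative in
    (∀ {n : ℕ} {ι : Type*} (s : Finset ι) (lam : ι → ℂ) (T : ι → 𝓢((Fin n → E4), ℂ)) (hT : ∀ i, IsTimeOrdered (T i)),
      IsTimeOrdered (∑ i ∈ s, lam i • T i)) ∧
    (∀ {S₁ : SchwingerFamily E4} (h : OSReconstructionNoE1 S₁.toLabelled) {n : ℕ} {ι : Type*} (s : Finset ι) (lam : ι → ℂ) (T : ι → 𝓢((Fin n → E4), ℂ)) (hT : ∀ i, IsTimeOrdered (T i)) (hs : IsTimeOrdered (∑ i ∈ s, lam i • T i)),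
      h.fieldVec n (fun _ => ()) (∑ i ∈ s, lam i • T i) hs = ∑ i ∈ s, lam i • h.fieldVec n (fun _ => ()) (T i) (hT i)) ∧
    (∀ {H : Type*} [NormedAddCommGroup H] [NormedSpace ℂ H] [CompleteSpace H] {ε R : ℝ} (hε : 0 < ε) (hR : 0 < R) {f g : ℂ → H} (hf : DifferentiableOn ℂ f {ζ : ℂ | |ζ.re| < ε ∧ |ζ.im| < R}) (hg : DifferentiableOn ℂ g {ζ : ℂ | |ζ.re| < ε ∧ |ζ.im| < R}) (hfg : ∀ θ : ℝ, |θ| < ε → f θ = g θ),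
      Set.EqOn f g {ζ : ℂ | |ζ.re| < ε ∧ |ζ.im| < R}) ∧
    (∀ {D : Type*} [NormedAddCommGroup D] [NormedSpace ℝ D] (F : 𝓢(D, ℂ)) (Fk : ℕ → 𝓢(D, ℂ)) (hFk : ∀ (k p q : ℕ), p ≤ k → q ≤ k → SchwartzMap.seminorm ℝ p q (F - Fk k) < 1 / ((k : ℝ) + 1)),
      Tendsto Fk atTop (𝓝 F)) :=
  ⟨@isTimeOrdered_finset_sum, @fieldVec_finset_sum, @eqOn_rect_of_eq_real, @tendsto_schwartz_of_seminorm⟩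

end Summit.QuantumFields.YangMills.Theorems.SoftKernelBoostCovariance.Sketch

end
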